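import Summits.ResolutionOfSingularities.ResolutionOfSingularities.Theorems.DeltaCutStellarHypSafe
import Summits.ResolutionOfSingularities.ResolutionOfSingularities.Theorems.DeltaCutStellarStrategyStar

/-!
# StellarCut T18 — «WildCut»: the WILD cell `WORNCHypWild` CARVED by labels, and THE WILD COPRIME LAW `worNCHypWildCop_holds`
# (lens-6 «barrier-complement carving», g34; critic ROW 237 window item (2) `WORNCHypWild n ⟸ WildWide n ∧ WildNarrow n`)

After T14 (`worNCHypTame_holds`) the hypersurface-shape n.c. law `WORNCHyp n` is its WILD cell `WORNCHypWild n` (`p ∣ n`, T8).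
THIS FILE carves the wild cell by the LABELS of the frame and DECIDES the wide half:

* §Cells — `IsNCHypStageCop p n N` (an s.n.c. hypersurface-shape frame whose labels are `0` or prime to `p`);
  `WORNCHypWildCop n` (= the binders of `WORNCHypWild n` verbatim with `p = n` and a COPRIME-LABELLED frame) and its exact
  complement `WORNCHypWildRest n` (`p ∣ n`, and `¬ (p = n ∧ coprime frame)`: the NARROW remainder — a label divisible by `p` at the
  pure-char marking, or `n = p·m` with `m ≥ 2`); the carve `worNCHypWild_iff_cop_rest` (a `by_cases`, exact); families
  `E1NCHypWildCop`, `E1NCHypWildRest`.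
* §CopShape — the list-level shape `ncHypShapeCop p` := `ncHypShapeF p` (T17a) ∧ `p` prime ∧ `p = 0` in every stalk ∧ the
  exponent of every boundary member `K` is `0` or prime to `p` along `V(K)`.  EVERY FACE OF A COPRIME DATUM IS SAFE
  (`ncHypShapeCop.safeFace`: a label prime to `p = char` is a stalk unit, `isUnit_natCast_of_cast_prime_eq_zero`, T15), so the
  safe-face round lemma (T17b `ncHypShapeF.transform_of_safe`) transforms the shape; what the strategy must protect is the NEW LABEL `weightOf E T − p`:
* §Labels — ★ `weightOf_sub_eq_zero_or_not_dvd_of_starBelowH`: along Kollár's star phases the new label stays in the class —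
  in phase `r = 2` it is `a_K − p` with `a_K` prime to `p`; in phase `r ≥ 3` the star bounds `(*ₛ)^H`, `s < r`, give
  `0 < weightOf E T − p < a_K < p`.  (FALSE for arbitrary face rounds — `{H, D₁(1), D₂(2p−1)}` has weight `2p` and creates the
  label `p` — whence the star variant `FaceStableShapeStar` of T16.)
* §Law — `faceStableShapeStar_ncHypShapeCop`, the bridge `exists_ncHypShapeCop_of_isNCHypStageCop` (`CharP k p ⇒ p = 0` in the
  stalks, `natCast_stalk_eq_zero_of_charP`; the frame's labels are the list's exponents, `NCFrame.expOf_cons_expList`, both T17b), and ★ **`worNCHypWildCop_holds :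
  ∀ n, 1 ≤ n → WORNCHypWildCop n`** by `FaceStableShapeStar.exists_weakResolution` (T16).  WILD-COPRIME desk inhabitant:
  `x² + z·w³` and `x³ + (1 + w)·z²w²` in characteristics `2` and `3` (labels `1, 3` resp. `2, 2`).
* §Carve (in the companion file `DeltaCutStellarWildCarve.lean` — writer split at the gate's 400-line limit, ROW 241 (ii),
  content verbatim) — the column's carve with the tame AND the wild-coprime cells discharged: `E1NCHypWildRest → E1NCEntryPerpetual →
  E1TopSFrozenOffNC → E1TopSHeavy` (and the edges to `E1TopGHeavy`, `E1TopNoAbs`, `E 1` under the standing asides).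

What `p = n` buys (and why `p ∣ n, p < n` is in the REST): with coprime labels a TIGHT face (`weightOf = n`) has fibre form
`X_Hⁿ + a·X^b` with `b` = the labels, all prime to `p`, so `∂_l` of the boundary variables sees it (T15 (E1)); for `n = p·m`,
`m ≥ 2`, the star phases create labels `≡ 0 (mod p)` (`p = 2, n = 4`: `(3,3) ↦ 2 ↦` the tight square face `(2,2)`), and the outcome
then depends on the jet of the unit `u` — the NARROW cell, undecided here.

SCOPE (honest). `WORNCHypWildCop n` has content exactly at the PRIME levels `n = p`: at a composite (or unit) level the clause
`p = n`, `p` prime, is absurd and the cell holds VACUOUSLY (closing `example : WORNCHypWildCop 4`).  The bound `dim Y ≤ 4` of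
`IsBase` is UNUSED (the coprime class is strategy-stable in every dimension).  The guard (E1, T15) is the `∂_{X_l}`-partial of the
SAME fibre form as g33's `∂_{X_H}`-guard (T10a) — one guard, two variables.  NOT CLAIMED: the NARROW cell `WORNCHypWildRest n`
(UNDECIDED · IDEA-NEEDED «JetCut»: the outcome depends on the jet of `u`, see its docstring for the test data), ROW 237 items (3)
(`SPerpetual 2 ⟨D₀, none⟩`) and (4) (the ENTRY instrument).  The located residual of the column shrinks from `WORNCHypWild` to
`WORNCHypWildRest` (§Carve).

0 sorry; axioms standard (`lean check --axioms …worNCHypWildCop_holds`: `propext`, `Classical.choice`, `Quot.sound`). [new]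
[cite: Kollar2007, (3.111) Step 3]
[cite: CossartPiltant2008, Prop. 4.2 (a)] [cite: BierstoneGrigorievMilmanWlodarczyk2011, §4 Step 2b]
-/

noncomputable section

open CategoryTheory CategoryTheory.Limits AlgebraicGeometry TopologicalSpace IsLocalRing
open Literature.AlgebraicGeometry.Resolution

namespace Summit.ResolutionOfSingularities.ResolutionOfSingularities.Theorems.DeltaCutClasses

open Summit.ResolutionOfSingularities.ResolutionOfSingularities.Theorems
open WeakOrderReduction ForcedTowerClasses

/-! ### §Cells — the wild cell carved by labels -/

section Cells

/-- **`IsNCHypStageCop p n N` — COPRIME-LABELLED hypersurface-shape n.c. stage**: an s.n.c. frame in the hypersurface shape with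
`SuppLE` (i.e. `IsNCHypStage n N`, T1) ALL OF WHOSE LABELS are `0` or prime to `p`. DEFINITION (letter · the wide wild class). -/
def IsNCHypStageCop (p n : ℕ) (N : Stage) : Prop :=
  ∃ F : NCFrame N, F.IsSNC ∧ F.HypShape n ∧ F.SuppLE n ∧ ∀ i, F.a i = 0 ∨ ¬ p ∣ F.a i

/-- a coprime-labelled stage is a hypersurface-shape n.c. stage -/
theorem isNCHypStage_of_cop {p n : ℕ} {N : Stage} (h : IsNCHypStageCop p n N) : IsNCHypStage n N := by
  obtain ⟨F, hS, hF, hSupp, -⟩ := h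
  exact ⟨F, hS, hF, hSupp⟩

/-- **`WORNCHypWildCop n` — THE WIDE WILD CELL**: the binders of `WORNCHypWild n` (T8) verbatim, at the PURE-CHARACTERISTIC marking
`p = n`, for COPRIME-LABELLED frames.  DECIDED · HOLDS (`worNCHypWildCop_holds`). -/
def WORNCHypWildCop (n : ℕ) : Prop :=
  ∀ p : ℕ, p.Prime → ∀ (k : Type) [Field k] [CharP k p] (Y : Scheme.{0}) (g : Y ⟶ Spec (.of k)),
    IsBase Y g → p = n → ∀ M : MarkedIdeal Y, IsDatum n M → IsNCHypStageCop p n ⟨Y, M.ideal⟩ →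
      ∃ t : CentreSeq Y, WeakResolution t M

/-- **`WORNCHypWildRest n` — THE NARROW WILD CELL** (exact complement inside `WORNCHypWild n`): `p ∣ n` and NOT (`p = n` with a
coprime-labelled frame) — a positive label `≡ 0 (mod p)` at the pure-characteristic marking, or `n = p·m`, `m ≥ 2`.
UNDECIDED · IDEA-NEEDED «JetCut».  TEST DATA (characteristic `2`, marking `2`, `H = (x)`, labels `(2, 2)` on `z, w`, first centre
the tight face `V(x, z, w)`): Hauser's kangaroo `x² + (1 + xz)·z²w²` — on the `D_z`-chart the top locus LEAVES `V(H')` in round 1;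
`x² + (1 + x)·z²w²` — the same in round 2; `x² + (1 + z)·z²w²` — CLEAN (the strategy resolves it).  The three frames are
indistinguishable by `IsNCHypStage 2`: the outcome depends on the JET of the unit `u` along the centre, which no label sees.
[cite: Hauser2010, §§3–5] [cite: Hauser2008Kangaroo] -/
def WORNCHypWildRest (n : ℕ) : Prop :=
  ∀ p : ℕ, p.Prime → ∀ (k : Type) [Field k] [CharP k p] (Y : Scheme.{0}) (g : Y ⟶ Spec (.of k)),
    IsBase Y g → p ∣ n → ∀ M : MarkedIdeal Y, IsDatum n M → IsNCHypStage n ⟨Y, M.ideal⟩ →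
      ¬ (p = n ∧ IsNCHypStageCop p n ⟨Y, M.ideal⟩) → ∃ t : CentreSeq Y, WeakResolution t M

/-- ★ **THE CARVE OF THE WILD CELL (exact)**: `WORNCHypWild n ⟺ WORNCHypWildCop n ∧ WORNCHypWildRest n`. [new] -/
theorem worNCHypWild_iff_cop_rest (n : ℕ) : WORNCHypWild n ↔ WORNCHypWildCop n ∧ WORNCHypWildRest n := by
  constructor
  · intro h
    exact ⟨fun p hp k _ _ Y g hB hpn M hM hS =>
        h p hp k Y g hB (Dvd.intro 1 (by rw [mul_one, hpn])) M hM (isNCHypStage_of_cop hS),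
      fun p hp k _ _ Y g hB hd M hM hS _ => h p hp k Y g hB hd M hM hS⟩
  · rintro ⟨hC, hR⟩ p hp k _ _ Y g hB hd M hM hS
    by_cases hc : p = n ∧ IsNCHypStageCop p n ⟨Y, M.ideal⟩
    · exact hC p hp k Y g hB hc.1 M hM hc.2
    · exact hR p hp k Y g hB hd M hM hS hc

/-- the wild cell from its two sub-cells -/
theorem worNCHypWild_of_cop_rest {n : ℕ} (hC : WORNCHypWildCop n) (hR : WORNCHypWildRest n) : WORNCHypWild n :=
  (worNCHypWild_iff_cop_rest n).mpr ⟨hC, hR⟩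

/-- the FAMILY of wide wild cells (all markings `n ≥ 1`) -/
def E1NCHypWildCop : Prop := ∀ n : ℕ, 1 ≤ n → WORNCHypWildCop n

/-- the FAMILY of narrow wild cells (all markings `n ≥ 1`): the column's LOCATED RESIDUAL after g34 (was `E1NCHypWild`, T14).
UNDECIDED · IDEA-NEEDED «JetCut». -/
def E1NCHypWildRest : Prop := ∀ n : ℕ, 1 ≤ n → WORNCHypWildRest n

/-- the carve of the wild family (exact). [new] -/
theorem e1NCHypWild_iff_cop_rest : E1NCHypWild ↔ E1NCHypWildCop ∧ E1NCHypWildRest :=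
  ⟨fun h => ⟨fun n hn => ((worNCHypWild_iff_cop_rest n).mp (h n hn)).1,
    fun n hn => ((worNCHypWild_iff_cop_rest n).mp (h n hn)).2⟩,
    fun h n hn => worNCHypWild_of_cop_rest (h.1 n hn) (h.2 n hn)⟩

end Cells

/-! ### §CopShape — the list-level coprime shape; every face is safe -/

section CopShape

variable {X : Scheme.{0}} {E : List (X.IdealSheafData × ℕ)} {H : X.IdealSheafData} {p : ℕ} {M : MarkedIdeal X}

/-- **THE COPRIME SHAPE `ncHypShapeCop p`** (a `Shape`): the unit-free hypersurface shape at marking `p` (T17a), `p` prime, `p = 0`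
in every stalk, and the exponent of every boundary member `K` is `0` or prime to `p` along `V(K)`. -/
def ncHypShapeCop (p : ℕ) : Shape := fun X E H M =>
  ncHypShapeF p X E H M ∧ p.Prime ∧ (∀ x : X, ((p : ℕ) : X.presheaf.stalk x) = 0) ∧
    ∀ (K : X.IdealSheafData) (y : X), y ∈ K.support → expOf E K = 0 ∨ ¬ p ∣ expOf E K

namespace ncHypShapeCop

/-- the underlying unit-free shape -/
theorem toF (hP : ncHypShapeCop p X E H M) : ncHypShapeF p X E H M := hP.1

/-- `p` is prime -/
theorem prime (hP : ncHypShapeCop p X E H M) : p.Prime := hP.2.1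

/-- `p = 0` in every stalk -/
theorem cast_eq_zero (hP : ncHypShapeCop p X E H M) (x : X) : ((p : ℕ) : X.presheaf.stalk x) = 0 := hP.2.2.1 x

/-- the exponents are `0` or prime to `p` along their divisors -/
theorem labels (hP : ncHypShapeCop p X E H M) {K : X.IdealSheafData} {y : X} (hy : y ∈ K.support) :
    expOf E K = 0 ∨ ¬ p ∣ expOf E K := hP.2.2.2 K y hy

/-- **EVERY FACE OF A COPRIME DATUM IS SAFE** (a label prime to `p = char` is a stalk unit, T15). [new] -/
theorem safeFace (hP : ncHypShapeCop p X E H M) (T : Finset X.IdealSheafData) : SafeFace p X E T :=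
  Or.inr (Or.inr fun _ _ y hy => (hP.labels hy).imp_right fun h =>
    isUnit_natCast_of_cast_prime_eq_zero hP.prime (hP.cast_eq_zero y) h)

end ncHypShapeCop

end CopShape

/-! ### §Labels — the new label along the star phases -/

section Labels

variable {X : Scheme.{0}} {E : List (X.IdealSheafData × ℕ)} {H : X.IdealSheafData} {T : Finset X.IdealSheafData} {p : ℕ}

/-- ★ **THE NEW LABEL STAYS IN THE COPRIME CLASS ALONG THE STAR PHASES.**  For an `r`-set `T ∋ H` of boundary members with the
`H`-exponent `0`, all exponents on `T` zero or prime to `p`, and the star bounds `(*ₛ)^H` (`s < r`: every `s`-set through `H` with a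
common point has weight `< p`): the new label `weightOf E T − p` is `0` or prime to `p` — phase `r = 2`: it is `a_K − p ≡ a_K`;
phase `r ≥ 3`: `weightOf E T = a_K + weightOf E (T ∖ K) < a_K + p` and `a_K ≤ weightOf E {H, K} < p`, so `0 < weightOf E T − p < p`.
[new] [cite: Kollar2007, (3.111) Step 3] -/
theorem weightOf_sub_eq_zero_or_not_dvd_of_starBelowH {r : ℕ} (hTrH : T ∈ incSubsetsH E H r) (hstar : StarBelowH E H p r)
    (hH0 : expOf E H = 0) (hcop : ∀ K ∈ T, expOf E K = 0 ∨ ¬ p ∣ expOf E K) :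
    weightOf E T - p = 0 ∨ ¬ p ∣ (weightOf E T - p) := by
  classical
  obtain ⟨hTr, hHT⟩ := mem_incSubsetsH_iff.mp hTrH
  obtain ⟨hTs, hcard, x, hx⟩ := mem_incSubsets_iff.mp hTr
  rcases Nat.lt_or_ge p (weightOf E T) with hlt | hge
  swap
  · exact Or.inl (Nat.sub_eq_zero_of_le hge)
  refine Or.inr fun hdvd => ?_
  have hdvdW : p ∣ weightOf E T := by
    rw [← Nat.sub_add_cancel hlt.le]
    exact (Nat.dvd_add_right hdvd).mpr (dvd_refl p)
  -- `weightOf E T = weightOf E (T.erase H)`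
  set S := T.erase H with hS
  have hWS : weightOf E T = weightOf E S := by
    have h := weightOf_insert E (Finset.notMem_erase H T) (K := H)
    rw [Finset.insert_erase hHT, hH0, zero_add] at h
    exact h
  by_cases hS1 : S.card ≤ 1
  · -- phase `r ≤ 2`: `S = ∅` or `S = {K}`
    obtain ⟨K, hSK⟩ := Finset.card_le_one_iff_subset_singleton.mp hS1
    rcases Finset.subset_singleton_iff.mp hSK with hS0 | hSeq
    · rw [hWS, hS0, weightOf_empty] at hlt
      exact absurd hlt (Nat.not_lt_zero p)
    · have hKS : K ∈ S := by rw [hSeq]; exact Finset.mem_singleton_self K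
      have hKT : K ∈ T := Finset.mem_of_mem_erase hKS
      have hWK : weightOf E T = expOf E K := by rw [hWS, hSeq]; rfl
      rcases hcop K hKT with h0 | hnd
      · rw [hWK, h0] at hlt
        exact absurd hlt (Nat.not_lt_zero p)
      · exact hnd (hWK ▸ hdvdW)
  · -- phase `r ≥ 3`: the star bounds
    push Not at hS1
    obtain ⟨K, hKS⟩ : S.Nonempty := Finset.card_pos.mp (by omega)
    have hKT : K ∈ T := Finset.mem_of_mem_erase hKS
    have hKH : K ≠ H := Finset.ne_of_mem_erase hKS
    have hST : S.card + 1 = T.card := Finset.card_erase_add_one hHT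
    have hr3 : 3 ≤ r := by omega
    have h1 : weightOf E (T.erase K) < p :=
      hstar (r - 1) (by omega) _ (mem_incSubsets_iff.mpr ⟨(Finset.erase_subset K T).trans hTs,
        by rw [Finset.card_erase_of_mem hKT, hcard], x, fun K' hK' => hx K' (Finset.mem_of_mem_erase hK')⟩)
        (Finset.mem_erase.mpr ⟨hKH.symm, hHT⟩)
    have h2 : weightOf E {H, K} < p := by
      refine hstar 2 (by omega) _ (mem_incSubsets_iff.mpr ⟨?_, Finset.card_pair hKH.symm, x, fun K' hK' => ?_⟩)
        (Finset.mem_insert_self H {K})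
      · exact Finset.insert_subset_iff.mpr ⟨hTs hHT, Finset.singleton_subset_iff.mpr (hTs hKT)⟩
      · rcases Finset.mem_insert.mp hK' with rfl | hK'
        · exact hx _ hHT
        · rw [Finset.mem_singleton.mp hK']; exact hx _ hKT
    have hWK : weightOf E T = expOf E K + weightOf E (T.erase K) := by
      have h := weightOf_insert E (Finset.notMem_erase K T) (K := K)
      rw [Finset.insert_erase hKT] at h
      exact h
    have hKle : expOf E K ≤ weightOf E {H, K} := weightOf_mono E (Finset.subset_insert H {K})
    exact Nat.not_dvd_of_pos_of_lt (by omega) (by omega) hdvd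

end Labels

/-! ### §Round — the coprime shape survives a STRATEGY round -/

section Round

variable {X X' : Scheme.{0}} [IsLocallyNoetherian X] {π : X' ⟶ X} {H : X.IdealSheafData}
  {E : List (X.IdealSheafData × ℕ)} {T : Finset X.IdealSheafData} {p : ℕ} {M : MarkedIdeal X}

/-- ★ **THE COPRIME SHAPE SURVIVES A STRATEGY ROUND**: the blow-up of the face of an `r`-set `T ∋ H` of weight `≥ p` in phase `r`
(star bounds `(*ₛ)^H`, `s < r`).  The shape part is the safe-face round lemma (T17b; every face of a coprime datum is safe); `p = 0`
is transported by the stalk maps; the exponents of the new boundary: a strict transform `K'` through a point keeps `expOf E K`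
(`eq_of_strictTransformIdeal_eq`), the exceptional divisor gets `weightOf E T − p` (`weightOf_transformExp`,
`strictTransformIdeal_ne_comap`), which §Labels keeps in the class. [new] [cite: Kollar2007, (3.111) Step 3] -/
theorem ncHypShapeCop.transform_star {r : ℕ} (hEs : HasSNC (H :: boundaryOf E)) (hT : ∀ K ∈ T, K ∈ H :: boundaryOf E)
    (hHT : H ∈ T) (hπ : IsBlowup π (T.sup id)) (hmT : p ≤ weightOf E T) (hTrH : T ∈ incSubsetsH E H r)
    (hstar : StarBelowH E H p r) (hP : ncHypShapeCop p X E H M) :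
    ncHypShapeCop p X' (transformExp E π T p) (strictTransformIdeal π (T.sup id) H) (M.transform π (T.sup id)) := by
  classical
  haveI : IsProper π := hπ.isProper
  haveI : IsLocallyNoetherian X' := LocallyOfFiniteType.isLocallyNoetherian π
  refine ⟨hP.toF.transform_of_safe hEs hT hHT hπ hmT hP.prime.two_le (hP.safeFace T), hP.prime, fun x' => ?_,
    fun G x' hx' => ?_⟩
  · have h := congrArg (π.stalkMap x').hom (hP.cast_eq_zero (π x'))
    rwa [map_natCast, map_zero] at h
  · -- the exponents of the new boundary members through `x'`
    rw [expOf, weightOf_transformExp]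
    by_cases hGF : (T.sup id).comap π ∈ ({G} : Finset X'.IdealSheafData)
    · -- the exceptional divisor: exponent `weightOf E T − p`
      have hGF' : (T.sup id).comap π = G := Finset.mem_singleton.mp hGF
      rw [if_pos hGF]
      have hxF : x' ∈ ((T.sup id).comap π).support := by rw [hGF']; exact hx'
      have hxC : π x' ∈ (T.sup id).support := by
        have h : x' ∈ ((((T.sup id).comap π).support : Set X')) := hxF
        rwa [Scheme.IdealSheafData.support_comap] at h
      have hyT : ∀ K ∈ T, π x' ∈ K.support := (mem_support_finsetSup_iff T (π x')).mp hxC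
      have hpre : pre E π T {G} = ∅ := by
        refine Finset.eq_empty_of_forall_notMem fun K hK => ?_
        obtain ⟨hKs, hKG⟩ := mem_pre_iff.mp hK
        rw [Finset.mem_singleton, ← hGF'] at hKG
        exact strictTransformIdeal_ne_comap hEs hT hπ (List.mem_cons_of_mem _ (mem_sheaves_iff.mp hKs)) hxF hKG
      rw [hpre, weightOf_empty, zero_add]
      have hH0 : expOf E H = 0 := expOf_eq_zero_of_labels fun q hq hqH =>
        (hP.toF.label_eq_zero hq hqH).resolve_right (Set.nonempty_iff_ne_empty.mp ⟨π x', hyT H hHT⟩)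
      exact weightOf_sub_eq_zero_or_not_dvd_of_starBelowH hTrH hstar hH0 fun K hK => hP.labels (hyT K hK)
    · -- a strict transform: exponent `expOf E K` of the unique old member behind it
      rw [if_neg hGF, add_zero]
      by_cases hex : ∃ K, K ∈ pre E π T {G}
      · obtain ⟨K, hK⟩ := hex
        obtain ⟨hKs, hKG⟩ := mem_pre_iff.mp hK
        rw [Finset.mem_singleton] at hKG
        have hxK' : x' ∈ (strictTransformIdeal π (T.sup id) K).support := by rw [hKG]; exact hx'
        have hxK : π x' ∈ K.support := mem_support_of_mem_support_strictTransformIdeal hxK'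
        have hpre : pre E π T {G} = {K} := by
          refine Finset.eq_singleton_iff_unique_mem.mpr ⟨hK, fun K' hK' => ?_⟩
          obtain ⟨hK's, hK'G⟩ := mem_pre_iff.mp hK'
          rw [Finset.mem_singleton] at hK'G
          exact (eq_of_strictTransformIdeal_eq hEs hT hπ (List.mem_cons_of_mem _ (mem_sheaves_iff.mp hKs))
            (List.mem_cons_of_mem _ (mem_sheaves_iff.mp hK's)) hxK' (hKG.trans hK'G.symm)).symm
        rw [hpre]
        exact hP.labels hxK
      · push Not at hex
        rw [Finset.eq_empty_of_forall_notMem fun K hK => hex K hK, weightOf_empty]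
        exact Or.inl rfl

/-- ★ **THE COPRIME SHAPE IS FACE-STABLE ALONG THE STRATEGY** (T16 `FaceStableShapeStar`). [new] -/
theorem faceStableShapeStar_ncHypShapeCop (p : ℕ) : FaceStableShapeStar p (ncHypShapeCop p) where
  round _ _ _ _ T _ _ hEs _ hT hHT hmT hTrH hstar hP :=
    hP.transform_star hEs hT hHT (blowup.isBlowup (T.sup id)) hmT hTrH hstar
  face _ _ _ _ _ _ hEs hHT hmT hP := support_finsetSup_subset_support_ncHypShapeF hEs hHT hmT hP.toF
  terminal _ _ _ _ _ hEs _ hP h := support_ncHypShapeF_eq_empty (hasSNC_boundaryOf_of_cons hEs) hP.toF h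

end Round

/-! ### §Law — the bridge from the binders and the wide wild law -/

section Law

open AlgebraicGeometry.Scheme.IdealSheafData (vanishingIdeal)

variable {Y : Scheme.{0}}

/-- **THE BRIDGE from the binders of `WORNCHypWildCop`**: a base `p`-datum over a field of characteristic `p` whose stage is a
COPRIME-LABELLED hypersurface-shape n.c. stage is a `ncHypShapeCop p`-datum for `E := (𝓘(H), 0) :: [(𝓘(Dᵢ), aᵢ)]ᵢ`, `H := 𝓘(F.H)`
(T17b's unit-free bridge; `p = 0` in the stalks; the exponents of `E` are the labels). [new] [folklore] -/
theorem exists_ncHypShapeCop_of_isNCHypStageCop {p : ℕ} (hp : p.Prime) {k : Type} [Field k] [CharP k p]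
    (g : Y ⟶ Spec (.of k)) (hB : IsBase Y g) {M : MarkedIdeal Y} (hM : IsDatum p M)
    (hNC : IsNCHypStageCop p p ⟨Y, M.ideal⟩) :
    ∃ (E : List (Y.IdealSheafData × ℕ)) (H : Y.IdealSheafData),
      HasSNC (H :: boundaryOf E) ∧ H ∈ boundaryOf E ∧ ncHypShapeCop p Y E H M := by
  obtain ⟨F, hS, hF, hSupp, hlab⟩ := hNC
  obtain ⟨hH, hEs, hP⟩ := ncHypShapeF_of_isBase g hB hM hS hF hSupp
  have hinj : ∀ i j, vanishingIdeal (F.D i) = vanishingIdeal (F.D j) → i = j := by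
    intro i j hij
    by_contra hne
    have hset : ((F.D i : Closeds Y) : Set Y) = (F.D j : Set Y) := by
      rw [← Scheme.IdealSheafData.coe_support_vanishingIdeal (Z := F.D i), hij,
        Scheme.IdealSheafData.coe_support_vanishingIdeal]
    exact hS.2.2.2.2.2 i j hne hset.le
  refine ⟨_, _, hEs, hH, hP, hp, natCast_stalk_eq_zero_of_charP p g, fun K y _ => ?_⟩
  rcases F.expOf_cons_expList hinj K with h0 | ⟨i, hi⟩
  · exact Or.inl h0
  · rw [hi]; exact hlab i

/-- ★★ **THE WIDE WILD LAW HOLDS** — `WORNCHypWildCop n` for every `n ≥ 1`: at the pure-characteristic marking `p = n`, a base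
`n`-datum whose stage is a COPRIME-LABELLED s.n.c. hypersurface-shape stage admits a weak resolution — by the strategy through
`H` (T16) on the coprime shape, every face being safe (T17b + T15) and every new label staying coprime along the star phases
(§Labels).  The cell `WORNCHypWildCop` of the carving `worNCHypWild_iff_cop_rest` is DECIDED · HOLDS; `WORNCHypWildRest` stays
UNDECIDED. [new] [cite: Kollar2007, (3.111) Step 3] [cite: CossartPiltant2008, Prop. 4.2 (a)] -/
theorem worNCHypWildCop_holds (n : ℕ) (_hn : 1 ≤ n) : WORNCHypWildCop n := by
  intro p hp k _ _ Y g hB hpn M hM hNC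
  subst hpn
  haveI := hB.locallyOfFiniteType
  haveI := hB.quasiCompact
  haveI : IsLocallyNoetherian Y := LocallyOfFiniteType.isLocallyNoetherian g
  obtain ⟨E, H, hEs, hH, hP⟩ := exists_ncHypShapeCop_of_isNCHypStageCop hp g hB hM hNC
  exact (faceStableShapeStar_ncHypShapeCop p).exists_weakResolution hEs hH M hP

/-- the FAMILY of wide wild laws `E1NCHypWildCop` holds. [new] -/
theorem e1NCHypWildCop_holds : E1NCHypWildCop := worNCHypWildCop_holds

-- the law, fully qualified, binders `n` / `1 ≤ n` only (critic (x2)); composite levels are VACUOUS (`p = n` with `p` prime).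
example : ∀ n : ℕ, 1 ≤ n → Summit.ResolutionOfSingularities.ResolutionOfSingularities.Theorems.DeltaCutClasses.WORNCHypWildCop n :=
  worNCHypWildCop_holds

example : WORNCHypWildCop 4 := fun p hp _ _ _ _ _ _ h4 => absurd (h4 ▸ hp) (by decide)

/-- per level, the wild cell now reduces to its NARROW remainder: `WORNCHypWildRest n → WORNCHypWild n`. [new] -/
theorem worNCHypWild_of_rest {n : ℕ} (hn : 1 ≤ n) (hR : WORNCHypWildRest n) : WORNCHypWild n :=
  worNCHypWild_of_cop_rest (worNCHypWildCop_holds n hn) hR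

/-- per level: `WORNCHypWildRest n → WORNCHyp n` (tame T14 + wide wild). [new] -/
theorem worNCHyp_of_wildRest {n : ℕ} (hn : 1 ≤ n) (hR : WORNCHypWildRest n) : WORNCHyp n :=
  worNCHyp_of_wild hn (worNCHypWild_of_rest hn hR)

/-- per level: the n.c.-regime part of the residual from the narrow wild cell alone, `WORNCHypWildRest n → WORTopSHeavyNC n`. [new] -/
theorem worTopSHeavyNC_of_wildRest {n : ℕ} (hn : 1 ≤ n) (hR : WORNCHypWildRest n) : WORTopSHeavyNC n :=
  worTopSHeavyNC_of_wild hn (worNCHypWild_of_rest hn hR)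

/-- families: `E1NCHypWildRest → E1NCHypWild`. [new] -/
theorem e1NCHypWild_of_rest (hR : E1NCHypWildRest) : E1NCHypWild := fun n hn => worNCHypWild_of_rest hn (hR n hn)

/-- families: `E1NCHypWildRest → E1NCHyp`. [new] -/
theorem e1NCHyp_of_wildRest (hR : E1NCHypWildRest) : E1NCHyp := e1NCHyp_of_wild (e1NCHypWild_of_rest hR)

end Law

end Summit.ResolutionOfSingularities.ResolutionOfSingularities.Theorems.DeltaCutClasses
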